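import Literature.MathematicalPhysics.QuantumFieldTheory.Balaban1983to89.B14DomainGeom
import Literature.MathematicalPhysics.QuantumFieldTheory.Balaban1983to89.B8ConstraintBonds

/-!
# T⁴ programme, SUBSTRATE — `Support/SmallFieldDomains`: the multi-index SMALL-FIELD GEOMETRY of [Balaban1985RegularSpaces] (1.3)–(1.5),
# [Balaban1985BackgroundPropagators] Sect. A p. 396 and [Balaban1985Variational] pp. 278–279 on `ℤ^d`, part 1/3:
# big-block domain sequences with the PRINTED radii, the POINT INDEX and the LAYERS `Ω_j ∖ Ω_{j+1} = B^j(Λ_j)`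

CITATION HEADER (lean-in-tree rule 2026-08-18).  Sources (papers UNDER ADJUDICATION by the audit cell `pub-balaban`;
nothing of them is asserted — this module DEFINES concrete `ℤ^d` readings of three printed geometric notions and PROVES
elementary facts about the definitions):
* [Balaban1985RegularSpaces] T. Bałaban, *Spaces of regular gauge field configurations on a lattice and gauge fixing
  conditions*, Commun. Math. Phys. **99** (1985) 75–102 (cell paper B8; journal page = PDF page + 74), p. 77 (1.3)–(1.5):
  *"Ω₀ ⊃ Ω₁ ⊃ Ω₂ ⊃ … ⊃ Ω_k, Ω_j ⊂ T_η (1.3) … Ω_j = B^j(Ω_j^{(j)}), Ω_j is a sum of cubes of a size M₁L^jη,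
  (L^jη)^{-1} dist(Ω_j^c, Ω_{j+1}) > RM₁. (1.4)"* — typed in `…B8ConstraintBonds` as `DomainSeq` with the WEAK radius
  `L^{j+1}`; here the printed radii are kept (`BigDomainSeq`, §1) and the bridge to `DomainSeq` is proved.
* [Balaban1985BackgroundPropagators] T. Bałaban, *Propagators for lattice gauge theories in a background field*, Commun.
  Math. Phys. **99** (1985) 389–434 (cell paper B9; journal page = PDF page + 388), p. 396 [PDF 8], read on the held text
  `paper:balaban1985-cmp99-background-propagators` p. 8: *"At first let us introduce a class of cubes. For each cube □ of
  this class there exists a unique index j, 0 ≤ j ≤ k, such that □ ⊂ B^j(Λ_j) ∪ B^{j+1}(Λ_{j+1}), □ ∩ B^j(Λ_j) ≠ ∅, and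
  □ is a union of several big blocks of the lattice T_{L−j} [sic: the lattice of spacing L^jη], which implies that
  its size in the lattice T_η is O(1)ML^jη. Here O(1) will mean a number ≧ 10."* (glyph «≧» re-read on the render
  `…1985-cmp99-background-propagators-p008-x2.png` by XREAD F-ne9leaf09g10-1 — v1 of this header had «≤ 10» from the OCR layer;
  corroboration p. 409: *"the number O(1) in the condition (3.35) can be taken as equal to 12"*; cell DIVERGENCE.md D-ne9leaf09g10-1)
  (§3: `IsClassCubeB9`, `ten_le : 10 ≤ nblk`; the asserted UNIQUENESS of the index is PROVED, `IsClassCubeB9.index_unique`).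
* [Balaban1985Variational] T. Bałaban, *The variational problem and background fields in renormalization group method
  for lattice gauge theories*, Commun. Math. Phys. **102** (1985) 277–309 (cell paper B11; journal page = PDF page +
  276), pp. 278–279 [PDF 2–3], read on the held text `paper:balaban1985-cmp102-variational-background` pp. 2–3: *"To
  formulate them we have to introduce a class of cubes. This class was described in Sect. F [6]. Each cube □ of this
  class is contained in B^j(Λ_j) ∪ B^{j+1}(Λ_{j+1}) = Ω_j∖Ω_{j+2} for some j between 0 and k, and is a union of big
  blocks of the L^{-j}-lattice. More exactly we assume that □ has a size 2ML^jη, where M is a multiple of R₁M₁, and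
  that the cube □̃ of the size (2M + 4R₁M₁)L^jη and with the same center as □, is contained in B^j(Λ_j) ∪
  B^{j+1}(Λ_{j+1}), but not in B^{j+1}(Λ_{j+1}). We consider all cubes □ satisfying the above conditions."* (§4:
  `IsClassCubeB11`).


WHAT THIS MODULE IS FOR (audit cell `pub-balaban`, SUBSTRATE cell seat p4, 2026-08-20; `substrate/SUBSTRATE-MAP.md` §p4;
three parts ≤ 400 lines sharing this namespace: this file = §0–§2, `Support/SmallFieldDomainsCubes` = §3–§4 (the two printed cube
classes, index uniqueness, the interior/collar class cubes), `Support/SmallFieldDomainsCover` = §5 (the covering lemma and the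
block-constant level map)).  The regularity classes [B9] (3.35)–(3.36) and the conclusions [B11] Thm 1 (9)–(10) are
INDEXED by this cube geometry (bounds `∝ (L^jη)^{-1,-2,-3}` on a cube of index `j`).  The tree so far types the GLOBAL
small-field case only (`Summits/…/Support/RegularBackgroundTower.RegularTransporters`: one index `j = k`; declared
non-applicability (i) of `t4/SKELETON-NE2-P1.md`: «LOCAL small-field regions / large-field holes … here: global small
field») and carries the per-level coverings of row NE7 as DISPLAYED binders over a free level map
(`Support/TermwiseLocalThm1Ledger.lean`, `hcoverA`/`hcoverB`/`hcoverBf`, with `lvlA`/`lvlB`).  Here, on the `ℤ^d` carriers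
shared by `…B14DomainGeom` (`Pt d`, `Within`, `cubeIdx`, `IsUnionOfCubes`, `pcube`) and `…B8ConstraintBonds` (`IsLevel`,
`Lam`, `DomainSeq`, the prelude's `blockMap`/`blockBase`) — imported BY NAME, bridged in §0/§2, nothing restated:
 * §0 cube refinement (`cubeIdx_mul`, `IsUnionOfCubes.of_mul`), `cubeIdx_eq_blockMap`, centred cubes `ccube`, corners;
 * §1 `BigDomainSeq L M₁ R k Ω` — (1.3)–(1.4) with the printed radii — and `BigDomainSeq.domainSeq` (⇒ `DomainSeq`);
 * §2 the POINT INDEX `ptIndex k Ω x = max{j ≤ k : x ∈ Ω_j}` and the LAYERS `layer Ω j = Ω_j ∖ Ω_{j+1}`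
   (`mem_layer_iff_ptIndex`, `layer_disjoint`, `iUnion_layer_eq`, [B11]'s `B^j(Λ_j) ∪ B^{j+1}(Λ_{j+1}) = Ω_j∖Ω_{j+2}`
   as `layer_union_layer_succ`, block-constancy `ptIndex_eq_of_cubeIdx_eq`, and the bridge to (1.5)
   `mem_layer_iff_blockBase_mem_Lam`: the layer IS `B^j(Λ_j)` with `Λ_j = B8ConstraintBonds.Lam L Ω j`).
HONEST FRAMING (T4-DAG p. 1).  Region BOOKKEEPING on `ℤ^d` (universal cover of the torus), fine-lattice units `η = 1`; no
configuration, no estimate, no torus identification; the printed sentences quoted above are DOCUMENTATION of what the three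
hypothesis SHAPES read (bracketed keys are CONTEXT, not cite tags) — nothing printed is asserted, no `def … : Prop` fact is minted;
PLACEMENT: the cell's own bookkeeping mathematics ⇒ `Summits/…/T4Continuum/Support/` (gate `lint.literature-cited-only`),
importing the `Literature.…Balaban1983to89.*` geometry modules (allowed direction).  NOT NE2/NE3/NE7 content; spine 0/9
unchanged; NOT infinite volume, NOT a mass gap, NOT Clay.  HONEST DEPENDENCY: continuum YM on T⁴ ⇐ BetaPertH ∧ nine spine
estimates (0/9 proved); BetaPertH ⇐ (D1) ∧ (D4) ∧ CAP+tail; G-an2-4 gates asym, D1 and NE2/3/4.  No `sorry`.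
-/

namespace Summit.QuantumFields.BalabanUV.T4Continuum.SmallFieldDomains

open Literature.MathematicalPhysics.QuantumFieldTheory.Balaban1983to89.B14DomainGeom
open Literature.MathematicalPhysics.QuantumFieldTheory.Balaban1983to89.B8ConstraintBonds (IsLevel Lam DomainSeq)
open Literature.MathematicalPhysics.QuantumLattice (blockMap blockBase)

variable {d : ℕ}

/-! ## §0 Cube refinement, the `cubeIdx = blockMap` bridge, boxes -/

/-- ONE GEOMETRY, TWO NAMES: `B14DomainGeom.cubeIdx s` IS the prelude's `QuantumLattice.blockMap s` (both are
coordinatewise floor division). [folklore] -/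
theorem cubeIdx_eq_blockMap (s : ℕ) (x : Pt d) : cubeIdx s x = blockMap s x := rfl

/-- Nested partitions: the side-`s·t` cube index is the side-`t` index of the side-`s` index
(`⌊⌊x/s⌋/t⌋ = ⌊x/(st)⌋`). [folklore] -/
theorem cubeIdx_mul (s t : ℕ) (x : Pt d) : cubeIdx (s * t) x = cubeIdx t (cubeIdx s x) := by
  funext i
  simp only [cubeIdx, Nat.cast_mul]
  exact (Int.ediv_ediv_of_nonneg (Int.natCast_nonneg s)).symm

/-- Points in the same side-`s` cube are in the same side-`s·t` cube. [folklore] -/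
theorem cubeIdx_mul_eq_of_eq (s t : ℕ) {x y : Pt d} (h : cubeIdx s x = cubeIdx s y) :
    cubeIdx (s * t) x = cubeIdx (s * t) y := by
  rw [cubeIdx_mul, cubeIdx_mul, h]

/-- A union of side-`s·t` cubes is a union of side-`s` cubes (the finer partition refines the coarser). [folklore] -/
theorem IsUnionOfCubes.of_mul {s t : ℕ} {Λ : Set (Pt d)} (h : IsUnionOfCubes (s * t) Λ) : IsUnionOfCubes s Λ :=
  fun _ _ hxy => h _ _ (cubeIdx_mul_eq_of_eq s t hxy)

/-- A union of side-`s·t` cubes is a union of side-`t` cubes. [folklore] -/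
theorem IsUnionOfCubes.of_mul' {s t : ℕ} {Λ : Set (Pt d)} (h : IsUnionOfCubes (s * t) Λ) : IsUnionOfCubes t Λ := by
  rw [mul_comm] at h; exact IsUnionOfCubes.of_mul h

/-- The empty set is a union of cubes. [folklore] -/
theorem isUnionOfCubes_empty (s : ℕ) : IsUnionOfCubes s (∅ : Set (Pt d)) := fun _ _ _ => Iff.rfl

/-- The whole lattice is a union of cubes. [folklore] -/
theorem isUnionOfCubes_univ (s : ℕ) : IsUnionOfCubes s (Set.univ : Set (Pt d)) := fun _ _ _ => Iff.rfl

/-- The CENTRED half-open cube of half-side `h` about `c`: `{y | −h ≤ y_i − c_i < h}` (side `2h`; for `c` a point of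
the `M₁L^j`-lattice and `M₁L^j ∣ h` it is a union of big blocks — Bałaban's «cube of the size 2ML^jη with center …»).
[folklore] -/
def ccube (c : Pt d) (h : ℤ) : Set (Pt d) := {y | ∀ i, -h ≤ y i - c i ∧ y i - c i < h}

/-- Membership in a centred cube, unfolded. [folklore] -/
theorem mem_ccube {c : Pt d} {h : ℤ} {y : Pt d} : y ∈ ccube c h ↔ ∀ i, -h ≤ y i - c i ∧ y i - c i < h := Iff.rfl

/-- Centred cubes grow with the half-side. [folklore] -/
theorem ccube_mono (c : Pt d) {h h' : ℤ} (hh : h ≤ h') : ccube c h ⊆ ccube c h' :=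
  fun _ hy i => ⟨by linarith [(hy i).1], by linarith [(hy i).2]⟩

/-- The centre lies in its cube (`0 < h`). [folklore] -/
theorem centre_mem_ccube (c : Pt d) {h : ℤ} (hh : 0 < h) : c ∈ ccube c h := fun i => by simp [hh, hh.le]

/-- A sup-ball about a point of the cube that keeps `t` away from the faces stays in the cube: if
`−h + t ≤ x_i − c_i < h − t` then `Within t x y → y ∈ ccube c h`. [folklore] -/
theorem mem_ccube_of_within {c x y : Pt d} {h t : ℤ} (hx : ∀ i, -h + t ≤ x i - c i ∧ x i - c i < h - t)
    (hy : Within t x y) : y ∈ ccube c h := fun i => by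
  obtain ⟨h1, h2⟩ := hx i
  obtain ⟨h3, h4⟩ := abs_le.mp (hy i)
  exact ⟨by linarith, by linarith⟩

/-- Points of a centred cube are within `h` of the centre (indeed `< h` above). [folklore] -/
theorem within_of_mem_ccube {c y : Pt d} {h : ℤ} (hy : y ∈ ccube c h) : Within h c y := fun i => by
  obtain ⟨h1, h2⟩ := hy i
  rw [abs_sub_comm, abs_le]; exact ⟨h1, h2.le⟩

/-- The lower corner `s·(cubeIdx s x)` of the partition cube of `x`. [folklore] -/
def corner (s : ℕ) (x : Pt d) : Pt d := fun i => (s : ℤ) * cubeIdx s x i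

/-- `x` lies in its partition cube, cornerwise: `0 ≤ x_i − corner_i < s`. [folklore] -/
theorem corner_le_lt (s : ℕ) (hs : 0 < s) (x : Pt d) (i : Fin d) :
    0 ≤ x i - corner s x i ∧ x i - corner s x i < s := by
  have h1 := cubeIdx_le s hs x i
  have h2 := lt_cubeIdx s hs x i
  simp only [corner]
  exact ⟨by linarith, by linarith⟩

/-- The corner is a point of the side-`s` lattice: every coordinate is divisible by `s`. [folklore] -/
theorem dvd_corner (s : ℕ) (x : Pt d) (i : Fin d) : (s : ℤ) ∣ corner s x i := ⟨_, rfl⟩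

/-- The corner of `x` depends only on the partition cube of `x`. [folklore] -/
theorem corner_eq_of_cubeIdx_eq (s : ℕ) {x y : Pt d} (h : cubeIdx s x = cubeIdx s y) : corner s x = corner s y := by
  funext i; simp only [corner, h]

/-- `x` is within `s` of its corner (sharper: `0 ≤ x − corner < s`). [folklore] -/
theorem within_corner (s : ℕ) (hs : 0 < s) (x : Pt d) : Within s (corner s x) x := fun i => by
  obtain ⟨h1, h2⟩ := corner_le_lt s hs x i
  rw [abs_sub_comm, abs_le]; exact ⟨by linarith, h2.le⟩

/-! ## §1 Big-block domain sequences: B8 (1.3)–(1.4) with the printed radii -/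

/-- **B8 (1.3)–(1.4) p. 77 WITH THE PRINTED RADII** (fine-lattice units `η = 1`; `ℤ^d` as universal cover of `T_η`), for
`k` levels: `anti` — *"Ω₀ ⊃ Ω₁ ⊃ … ⊃ Ω_k"*; `cubes` — *"Ω_j is a sum of cubes of a size M₁L^jη"* (a union of cubes of the
side-`M₁L^j` partition); `sep` — *"(L^jη)^{-1} dist(Ω_j^c, Ω_{j+1}) > RM₁"* read in the sup-metric: the sup-ball of
radius `R·M₁·L^j` about a point of `Ω_{j+1}` lies in `Ω_j`; `above` — no domains beyond level `k` (`Ω_j = ∅`, `j > k`;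
harmless and convenient, as in `B8ConstraintBonds.DomainSeq`).  A hypothesis STRUCTURE on data; nothing is asserted
about any particular sequence (typed READING of [Balaban1985RegularSpaces] (1.3)–(1.4) p. 77; hypothesis shape). [folklore] -/
structure BigDomainSeq (L M₁ R k : ℕ) (Ω : ℕ → Set (Pt d)) : Prop where
  /-- (1.3) nesting -/
  anti : ∀ j, Ω (j + 1) ⊆ Ω j
  /-- (1.4) `Ω_j` is a union of `M₁L^j`-cubes -/
  cubes : ∀ j, IsUnionOfCubes (M₁ * L ^ j) (Ω j)
  /-- (1.4) separation `dist(Ω_jᶜ, Ω_{j+1}) > R M₁ L^j` (sup-metric reading) -/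
  sep : ∀ j x, x ∈ Ω (j + 1) → ∀ y, Within ((R : ℤ) * M₁ * L ^ j) x y → y ∈ Ω j
  /-- no domains above level `k` -/
  above : ∀ j, k < j → Ω j = ∅

namespace BigDomainSeq

variable {L M₁ R k : ℕ} {Ω : ℕ → Set (Pt d)}

/-- (1.3) iterated: `Ω_m ⊆ Ω_n` for `n ≤ m`. [folklore] -/
theorem anti_le (h : BigDomainSeq L M₁ R k Ω) {n m : ℕ} (hnm : n ≤ m) : Ω m ⊆ Ω n :=
  antitone_nat_of_succ_le h.anti hnm

/-- `Ω_{k+1} = ∅`. [folklore] -/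
theorem empty_succ (h : BigDomainSeq L M₁ R k Ω) : Ω (k + 1) = ∅ := h.above _ (Nat.lt_succ_self k)

/-- A point of `Ω_j` has `j ≤ k`. [folklore] -/
theorem le_of_mem (h : BigDomainSeq L M₁ R k Ω) {j : ℕ} {x : Pt d} (hx : x ∈ Ω j) : j ≤ k := by
  by_contra hj
  have := h.above j (by omega)
  rw [this] at hx
  exact hx

/-- `Ω_j` is a union of `M₁L^i`-cubes for every `i ≤ j` (coarser partitions refine to finer ones). [folklore] -/
theorem cubes_le (h : BigDomainSeq L M₁ R k Ω) {i j : ℕ} (hij : i ≤ j) : IsUnionOfCubes (M₁ * L ^ i) (Ω j) := by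
  have e : M₁ * L ^ j = M₁ * L ^ i * L ^ (j - i) := by
    rw [mul_assoc, ← pow_add, Nat.add_sub_cancel' hij]
  have hc := h.cubes j
  rw [e] at hc
  exact IsUnionOfCubes.of_mul hc

/-- `Ω_j` is a union of `L^i`-blocks for `i ≤ j` (the reading `Ω_j = B^j(Ω_j^{(j)})` of (1.4) and its refinements).
[folklore] -/
theorem blocks_le (h : BigDomainSeq L M₁ R k Ω) {i j : ℕ} (hij : i ≤ j) : IsUnionOfCubes (L ^ i) (Ω j) := by
  have hc := h.cubes_le hij
  rw [mul_comm] at hc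
  exact IsUnionOfCubes.of_mul hc

/-- **BRIDGE to `B8ConstraintBonds.DomainSeq`**: the printed radii imply the weak ones (`L^{j+1} ≤ R·M₁·L^j` as soon as
`L ≤ R·M₁`). [folklore] -/
theorem domainSeq (h : BigDomainSeq L M₁ R k Ω) (hL : L ≤ R * M₁) : DomainSeq L Ω where
  anti := h.anti
  sat n x y hxy hx := by
    have hb : cubeIdx (L ^ n) x = cubeIdx (L ^ n) y := by
      rw [cubeIdx_eq_blockMap, cubeIdx_eq_blockMap]; exact_mod_cast hxy
    exact (h.blocks_le le_rfl x y hb).mp hx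
  sep n x t hx ht := by
    refine h.sep n x hx (x + t) fun i => ?_
    have h1 := ht i
    have h2 : ((L : ℤ) ^ (n + 1)) ≤ (R : ℤ) * M₁ * L ^ n := by
      have : ((L : ℕ) : ℤ) ^ (n + 1) = (L : ℤ) * L ^ n := by ring
      rw [this]
      have hL' : (L : ℤ) ≤ (R : ℤ) * M₁ := by exact_mod_cast hL
      exact mul_le_mul_of_nonneg_right hL' (by positivity)
    simp only [Pi.add_apply, sub_add_cancel_left, abs_neg]
    exact h1.trans h2

end BigDomainSeq

/-! ## §2 The point index and the layers `Ω_j ∖ Ω_{j+1} = B^j(Λ_j)` -/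

/-- The LAYER of index `j`: `Ω_j ∖ Ω_{j+1}` — as a set of fine points this is `B^j(Λ_j)`, `Λ_j = Ω_j^{(j)} ∖ Ω_{j+1}^{(j)}`
(B8 (1.5); see `mem_layer_iff_blockBase_mem_Lam`), and [B11] p. 279 prints `B^j(Λ_j) ∪ B^{j+1}(Λ_{j+1}) = Ω_j∖Ω_{j+2}`
(`layer_union_layer_succ`). [folklore] -/
def layer (Ω : ℕ → Set (Pt d)) (j : ℕ) : Set (Pt d) := Ω j \ Ω (j + 1)

/-- Membership in a layer, unfolded. [folklore] -/
theorem mem_layer {Ω : ℕ → Set (Pt d)} {j : ℕ} {x : Pt d} : x ∈ layer Ω j ↔ x ∈ Ω j ∧ x ∉ Ω (j + 1) := Iff.rfl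

open Classical in
/-- The POINT INDEX `ι(x) = max{j ≤ k : x ∈ Ω_j}` (and `0` if `x ∉ Ω₀`): the unique `j` with `x ∈ Ω_j ∖ Ω_{j+1}` for a
nested sequence (`mem_layer_iff_ptIndex`). [folklore] -/
noncomputable def ptIndex (k : ℕ) (Ω : ℕ → Set (Pt d)) (x : Pt d) : ℕ := Nat.findGreatest (fun j => x ∈ Ω j) k

section Index
variable {L M₁ R k : ℕ} {Ω : ℕ → Set (Pt d)}

/-- `ι(x) ≤ k`. [folklore] -/
theorem ptIndex_le (k : ℕ) (Ω : ℕ → Set (Pt d)) (x : Pt d) : ptIndex k Ω x ≤ k := by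
  classical
  exact Nat.findGreatest_le k

/-- A point of `Ω₀` lies in `Ω_{ι(x)}`. [folklore] -/
theorem mem_ptIndex {x : Pt d} (hx : x ∈ Ω 0) : x ∈ Ω (ptIndex k Ω x) := by
  classical
  exact Nat.findGreatest_spec (P := fun j => x ∈ Ω j) (Nat.zero_le k) hx

/-- No point lies in a domain strictly above its index (up to level `k`). [folklore] -/
theorem not_mem_of_ptIndex_lt {x : Pt d} {j : ℕ} (hj : ptIndex k Ω x < j) (hjk : j ≤ k) : x ∉ Ω j := by
  classical
  exact Nat.findGreatest_is_greatest (P := fun j => x ∈ Ω j) hj hjk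

/-- `x ∈ Ω_j`, `j ≤ k` ⇒ `j ≤ ι(x)`. [folklore] -/
theorem le_ptIndex_of_mem {x : Pt d} {j : ℕ} (hjk : j ≤ k) (hx : x ∈ Ω j) : j ≤ ptIndex k Ω x := by
  classical
  exact Nat.le_findGreatest (P := fun j => x ∈ Ω j) hjk hx

/-- For a `BigDomainSeq`: `x ∉ Ω_{ι(x)+1}`. [folklore] -/
theorem not_mem_ptIndex_succ (h : BigDomainSeq L M₁ R k Ω) (x : Pt d) : x ∉ Ω (ptIndex k Ω x + 1) := by
  intro hx
  have hle : ptIndex k Ω x + 1 ≤ k := h.le_of_mem hx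
  exact not_mem_of_ptIndex_lt (Nat.lt_succ_self _) hle hx

/-- For a `BigDomainSeq` and `j ≤ k`, `x ∈ Ω₀`: `x ∈ Ω_j ↔ j ≤ ι(x)`. [folklore] -/
theorem mem_iff_le_ptIndex (h : BigDomainSeq L M₁ R k Ω) {x : Pt d} (hx : x ∈ Ω 0) {j : ℕ} :
    x ∈ Ω j ↔ j ≤ ptIndex k Ω x := by
  constructor
  · intro hj
    exact le_ptIndex_of_mem (h.le_of_mem hj) hj
  · intro hj
    exact h.anti_le hj (mem_ptIndex hx)

/-- **The layers are the level sets of the index**: for `x ∈ Ω₀`, `x ∈ Ω_j ∖ Ω_{j+1} ↔ ι(x) = j`. [folklore] -/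
theorem mem_layer_iff_ptIndex (h : BigDomainSeq L M₁ R k Ω) {x : Pt d} (hx : x ∈ Ω 0) {j : ℕ} :
    x ∈ layer Ω j ↔ ptIndex k Ω x = j := by
  rw [mem_layer, mem_iff_le_ptIndex h hx, mem_iff_le_ptIndex h hx]
  omega

/-- Every point of `Ω₀` lies in the layer of its index. [folklore] -/
theorem mem_layer_ptIndex (h : BigDomainSeq L M₁ R k Ω) {x : Pt d} (hx : x ∈ Ω 0) :
    x ∈ layer Ω (ptIndex k Ω x) :=
  (mem_layer_iff_ptIndex h hx).mpr rfl

/-- A point of a layer is a point of `Ω₀`. [folklore] -/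
theorem mem_zero_of_mem_layer (h : BigDomainSeq L M₁ R k Ω) {x : Pt d} {j : ℕ} (hx : x ∈ layer Ω j) :
    x ∈ Ω 0 :=
  h.anti_le (Nat.zero_le j) hx.1

/-- The layers of a nested sequence are pairwise disjoint. [folklore] -/
theorem layer_disjoint (h : BigDomainSeq L M₁ R k Ω) {i j : ℕ} (hij : i ≠ j) :
    Disjoint (layer Ω i) (layer Ω j) := by
  rw [Set.disjoint_left]
  intro x hxi hxj
  have h0 := mem_zero_of_mem_layer h hxi
  rw [mem_layer_iff_ptIndex h h0] at hxi hxj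
  exact hij (hxi.symm.trans hxj)
  
/-- The layers `j ≤ k` exhaust `Ω₀`. [folklore] -/
theorem iUnion_layer_eq (h : BigDomainSeq L M₁ R k Ω) : (⋃ j ∈ Finset.range (k + 1), layer Ω j) = Ω 0 := by
  ext x
  simp only [Set.mem_iUnion, Finset.mem_range, exists_prop]
  constructor
  · rintro ⟨j, -, hj⟩
    exact mem_zero_of_mem_layer h hj
  · intro hx
    exact ⟨ptIndex k Ω x, Nat.lt_succ_of_le (ptIndex_le k Ω x), mem_layer_ptIndex h hx⟩

/-- [B11] p. 279: `B^j(Λ_j) ∪ B^{j+1}(Λ_{j+1}) = Ω_j ∖ Ω_{j+2}`. [folklore] -/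
theorem layer_union_layer_succ (h : BigDomainSeq L M₁ R k Ω) (j : ℕ) :
    layer Ω j ∪ layer Ω (j + 1) = Ω j \ Ω (j + 2) := by
  ext x
  simp only [Set.mem_union, mem_layer, Set.mem_sdiff]
  have h1 : x ∈ Ω (j + 1) → x ∈ Ω j := fun hx => h.anti j hx
  have h2 : x ∈ Ω (j + 2) → x ∈ Ω (j + 1) := fun hx => h.anti (j + 1) hx
  tauto

/-- The index is constant on the `M₁L^i`-cubes of every level `i ≥ 1`... more usefully: points in the same
`L`-block have the same index, PROVIDED `Ω₀` is itself a union of `L`-blocks (e.g. `Ω₀ = T`). [folklore] -/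
theorem ptIndex_eq_of_cubeIdx_eq (h : BigDomainSeq L M₁ R k Ω) (h0 : IsUnionOfCubes L (Ω 0)) {x y : Pt d}
    (hxy : cubeIdx L x = cubeIdx L y) : ptIndex k Ω x = ptIndex k Ω y := by
  classical
  have key : ∀ j, x ∈ Ω j ↔ y ∈ Ω j := by
    intro j
    rcases j with _ | j
    · exact h0 x y hxy
    · have hb : IsUnionOfCubes L (Ω (j + 1)) := by
        have := h.blocks_le (i := 1) (j := j + 1) (by omega)
        simpa using this
      exact hb x y hxy
  unfold ptIndex
  congr 1
  funext j
  exact propext (key j)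

/-- **BRIDGE to B8 (1.5)**: for `j ≤ k`... for every `j`, a fine point `x` lies in the layer `Ω_j ∖ Ω_{j+1}` iff the
level-`j` lattice point `L^j·⌊x/L^j⌋` of its block lies in `B8ConstraintBonds.Lam L Ω j = Λ_j` — i.e. the layer IS
`B^j(Λ_j)` as a set of fine points. [folklore] -/
theorem mem_layer_iff_blockBase_mem_Lam (h : BigDomainSeq L M₁ R k Ω) (hL : 0 < L) (j : ℕ) (x : Pt d) :
    x ∈ layer Ω j ↔ blockBase (L ^ j) (blockMap (L ^ j) x) ∈ Lam L Ω j := by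
  have hLj : 0 < L ^ j := pow_pos hL j
  -- the block corner has the same `L^j`-cube index as `x`
  have hidx : cubeIdx (L ^ j) (blockBase (L ^ j) (blockMap (L ^ j) x)) = cubeIdx (L ^ j) x := by
    rw [cubeIdx_eq_blockMap, cubeIdx_eq_blockMap]
    haveI : NeZero (L ^ j) := ⟨hLj.ne'⟩
    exact Literature.MathematicalPhysics.QuantumLattice.blockMap_blockBase (L ^ j) _
  have hj : x ∈ Ω j ↔ blockBase (L ^ j) (blockMap (L ^ j) x) ∈ Ω j :=
    (h.blocks_le le_rfl _ _ hidx.symm)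
  have hj1 : x ∈ Ω (j + 1) ↔ blockBase (L ^ j) (blockMap (L ^ j) x) ∈ Ω (j + 1) :=
    (h.blocks_le (Nat.le_succ j) _ _ hidx.symm)
  have hlev : IsLevel L j (blockBase (L ^ j) (blockMap (L ^ j) x)) :=
    Literature.MathematicalPhysics.QuantumFieldTheory.Balaban1983to89.B8ConstraintBonds.isLevel_blockBase L j _
  simp only [mem_layer, Lam, Set.mem_setOf_eq, hj, hj1, hlev, true_and]

end Index

end Summit.QuantumFields.BalabanUV.T4Continuum.SmallFieldDomains
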